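import Literature.NumberTheory.EllipticCurves.Kato2004.Condition1252
import Literature.NumberTheory.EllipticCurves.IsogenyFrobeniusTraceProofs
import HarnessLib

/-!
# Kato's (12.5.2) at `p = 3` from surj(3) and ONE Frobenius: the mod-`9` certificate

Topic `Literature/NumberTheory/EllipticCurves` (cell `b2b-bsdres`, literature seat lit-kato gen 6,
2026-08-21).  Theorems only — no definition, no named fact.

The integral statements of K. Kato, Astérisque 295 (2004) — Thm. 12.5 (4) (p. 222), Thm. 13.4 (3)
(p. 226), Thm. 14.5 (3) (p. 236), Thm. 17.4 (3) (p. 273) — require the image condition (12.5.2),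
which for `T = T_pE` of an elliptic curve `E/ℚ` is `Kato2004.ImageContainsSL2 W p` and is
EQUIVALENT to "`ρ̄_{E,p^n}` onto for every `n`" (`Condition1252.lean`).  For `p ≥ 5` this is the
census bit surj(p) (Serre's lifting lemma, *Abelian `ℓ`-adic representations* IV-23, Lemma 3); at
`p = 3` the lifting "surj(3) ⟹ surj(9)" is FALSE in general: Serre noted that
`SL₂(ℤ/9) → SL₂(𝔽₃)` has a section, and Elkies (arXiv:math/0612734, Introduction and §1)
parametrised the elliptic curves over `ℚ` with `ρ̄_{E,3}` onto but `ρ̄_{E,9}` not onto by a rational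
curve `X(9)/G` of degree `27` over the `j`-line (infinitely many `j ∈ ℚ`; the simplest are
`4374, 419904, -44789760`).  So at `p = 3` a certificate at level `9` is genuinely needed
(`Condition1252.lean`: (12.5.2) at `3` ⟺ surj(9) ⟺ `∀ n`, surj(3^n); Wuthrich 2014 Lemma 20
supplies it from surj(3) only when `9 ∤ N`, and the cell's `j`-witness lever
`Summits/…/GaloisImage/JWitnessTowerSurjectivity.lean` only when some pole of `j` has order prime
to `3`).

This file proves a certificate that needs NOTHING about the reduction of `E` at `3` and only two
residues modulo `9`:

* `WeierstrassCurve.forall_hasSurjectiveModNGaloisRep_three_pow_of_frobenius` — for a globally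
  minimal elliptic curve `W/ℚ` with `ρ̄_{W,3}` onto and ONE prime `ℓ` of good reduction with
  **`ℓ ≡ 2 or 5 (mod 9)` and `a_ℓ ≡ 3 or 6 (mod 9)`**, `ρ̄_{W,3^n}` is onto for every `n`;
* `WeierstrassCurve.hasSurjectiveModNGaloisRep_nine_of_frobenius` — in particular surj(9);
* `Kato2004.imageContainsSL2_three_of_frobenius` — hence Kato's (12.5.2) for `T_3E`.

Proof.  An arithmetic Frobenius `φ` at a prime of `\bar ℤ` over `ℓ` acts on `T_3E` with trace `a_ℓ`
and determinant `ℓ` (Silverman, *AEC*, C.21 Remark 21.3: the tree's theorems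
`trace_galoisRepTate_frobenius_eq_frobeniusTrace` and
`det_galoisRepTate_frobenius_of_hasGoodReductionAt_holds`).  By Cayley–Hamilton
`ρ(φ)² = a_ℓ ρ(φ) - ℓ = 1 + 3 M₀` with `M₀ := (a_ℓ/3) ρ(φ) - (ℓ+1)/3` (integers `a_ℓ/3`, `(ℓ+1)/3`).
Modulo `3`, `ρ(φ)` has characteristic polynomial `X² - a_ℓ X + ℓ ≡ X² - 1 = (X - 1)(X + 1)`, so it
is not a scalar; hence `M₀ mod 3` is not a scalar (`9 ∤ a_ℓ`), and
`tr M₀ = a_ℓ²/3 - 2(ℓ+1)/3 ≡ (ℓ+1)/3 ≢ 0 (mod 3)` (`9 ∤ ℓ+1`).  Such a first-order kernel witness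
together with surj(3) gives the whole tower:
`WeierstrassCurve.forall_hasSurjectiveModNGaloisRep_of_firstOrderWitness` (`Condition1252.lean`:
the `GL₂(𝔽₃)`-stable subgroups of `1 + 3 M₂(𝔽₃)` are `0`, the scalars, `sl₂` and everything, so one
element that is neither scalar nor traceless forces `im ρ̄_9 ⊇ ker(GL₂(ℤ/9) → GL₂(𝔽₃))`, i.e.
surj(9); then Serre's inductive step).  By Chebotarev such an `ℓ` exists as soon as `ρ̄_{E,9}` is
onto — the class `{diag(α, β) : α ≡ 1, β ≡ 2 (mod 3), αβ ∈ {2, 5}, α + β ∈ {3, 6} (mod 9)}` of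
`GL₂(ℤ/9)` is non-empty (density `1/9`) — informational, not used.

Use (cell `b2b-bsdres`, class X4 at `p = 3`, `r_an = 0`): the rows whose `3`-adic tower
surjectivity had no (ram)/`j`-witness prime were certified so far by ENGINES only (sha-2 img3adic;
additive-p4 gen 13's Frobenius engine of a different shape — a Frobenius `≡ 1 (mod 3)` plus
`#E(𝔽_ℓ)/9 mod 3`); with this file the bit is a KERNEL statement fed by `(ℓ, a_ℓ)`, and `a_ℓ` is a
kernel point count on an integer model (`Summits/…/Theorems/Rank1ResidualIntModelReduction.lean`,
`frobeniusTrace_eq`).  Census (cell file `b2b-bsdres-lit-kato/gen6/BETA-WITNESS-v21b.tsv`, pure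
python, two-engine on the traces): of additive-p4's `3 669` surj(3) rows, `3 649` have a witness
`ℓ ≤ 479` (median `29`) and the `20` without one are exactly the `20` curves of exotic `3`-adic image
(three `j`-invariants) found by both engines — as it must be, since on Elkies' group every such
`ρ(φ)²` is scalar modulo `9`.  Nothing is booked here; labels unchanged.

## References

* [Kato2004Asterisque] K. Kato, Astérisque 295 (2004), (12.5.2) in Thm. 12.5 (4) (p. 222);
  Thm. 17.4 (3) (p. 273).
* [SerreAbelianLadic1968] J.-P. Serre, *Abelian `ℓ`-adic representations and elliptic curves*
  (1968), Ch. IV §3.4, Lemma 3 (IV-23).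
* [Elkies2006] N. D. Elkies, *Elliptic curves with 3-adic Galois representation surjective mod 3
  but not mod 9*, arXiv:math/0612734 (2006), Introduction (p. 1) and §1.
* [SilvermanAEC2009] J. H. Silverman, *The Arithmetic of Elliptic Curves*, 2nd ed. (2009), C.21
  Remark 21.3 (trace and norm of Frobenius), III.§7.
-/

noncomputable section

open scoped Classical
open Field

namespace WeierstrassCurve

open Literature.NumberTheory.EllipticCurves Literature.NumberTheory.GaloisRepresentations
  NumberField IsDedekindDomain Rat.HeightOneSpectrum

section ThreeAdic

variable {R : Type*} [CommRing R] in
/-- Cayley–Hamilton for `2 × 2` matrices: `G² = tr(G) G - det(G)`. [folklore] -/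
private theorem mat_mul_self_eq (G : Matrix (Fin 2) (Fin 2) R) :
    G * G = G.trace • G - G.det • (1 : Matrix (Fin 2) (Fin 2) R) := by
  rw [Matrix.trace_fin_two, Matrix.det_fin_two]
  ext i j
  fin_cases i <;> fin_cases j <;>
    simp only [Matrix.sub_apply, Matrix.smul_apply, Matrix.mul_apply, Fin.sum_univ_two,
      Matrix.one_fin_two, Matrix.of_apply, Matrix.cons_val', Matrix.cons_val_zero,
      Matrix.cons_val_one, Matrix.empty_val', Matrix.cons_val_fin_one, Fin.zero_eta, Fin.mk_one,
      Fin.isValue, smul_eq_mul] <;> ring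

/-- An integer prime to `p` is a unit of `ℤ_p`. [folklore] -/
private theorem isUnit_intCast_of_not_dvd {p : ℕ} [Fact p.Prime] {k : ℤ} (hk : ¬ (p : ℤ) ∣ k) :
    IsUnit (k : ℤ_[p]) := by
  rw [PadicInt.isUnit_iff]
  exact le_antisymm (PadicInt.norm_le_one _)
    (not_lt.mp fun hlt ↦ hk ((PadicInt.norm_int_lt_one_iff_dvd k).mp hlt))

/-- A non-unit of `ℤ_p` is divisible by `p`. [folklore] -/
private theorem p_dvd_of_not_isUnit {p : ℕ} [Fact p.Prime] {z : ℤ_[p]} (hz : ¬ IsUnit z) :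
    (p : ℤ_[p]) ∣ z := by
  rw [PadicInt.isUnit_iff] at hz
  exact (PadicInt.norm_lt_one_iff_dvd z).mp (lt_of_le_of_ne (PadicInt.norm_le_one z) hz)

/-- A unit plus a multiple of `p` is a unit of `ℤ_p` (a local ring). [folklore] -/
private theorem isUnit_add_of_p_dvd {p : ℕ} [Fact p.Prime] {u z : ℤ_[p]} (hu : IsUnit u)
    (hz : (p : ℤ_[p]) ∣ z) : IsUnit (u + z) := by
  by_contra h
  have hz' : z ∈ IsLocalRing.maximalIdeal ℤ_[p] := by
    rw [PadicInt.maximalIdeal_eq_span_p]; exact Ideal.mem_span_singleton.mpr hz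
  have hu' : u + z - z ∈ IsLocalRing.maximalIdeal ℤ_[p] :=
    (IsLocalRing.maximalIdeal ℤ_[p]).sub_mem ((IsLocalRing.mem_maximalIdeal _).mpr h) hz'
  rw [add_sub_cancel_right] at hu'
  exact (IsLocalRing.mem_maximalIdeal _).mp hu' hu

/-- **The mod-`9` certificate: `3`-adic surjectivity from surj(3) and ONE Frobenius.**  Let
`E = W/ℚ` be an elliptic curve in global minimal form with `ρ̄_{E,3} : Γ_ℚ → Aut(E[3])` onto, and
let `ℓ` be a prime of good reduction with `ℓ ≡ 2, 5 (mod 9)` and `a_ℓ ≡ 3, 6 (mod 9)`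
(`a_ℓ = W.frobeniusTrace ℓ`).  Then `ρ̄_{E,3^n}` is onto for every `n` (`ρ_{E,3^∞}(Γ_ℚ) = GL₂(ℤ₃)`).
Proof: an arithmetic Frobenius `φ` at `ℓ` acts on `T_3E` with trace `a_ℓ` and determinant `ℓ`
(Silverman C.21.3), so by Cayley–Hamilton `ρ(φ²) = 1 + 3 M₀`, `M₀ = (a_ℓ/3) ρ(φ) - (ℓ+1)/3`, with
`M₀ mod 3` non-scalar and `tr M₀ ∈ ℤ₃ˣ`; conclude by
`forall_hasSurjectiveModNGaloisRep_of_firstOrderWitness`.  No hypothesis on the reduction of `E`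
at `3` (compare Wuthrich 2014 Lemma 20, which needs `9 ∤ N`); the lifting surj(3) ⟹ surj(9) being
false in general (Elkies 2006), the level-`9` input is necessary.
[cite: SerreAbelianLadic1968, Ch. IV §3.4, Lemma 3 (IV-23)] [cite: Elkies2006, Introduction (p. 1) and §1]
[cite: SilvermanAEC2009, C.21 Remark 21.3] -/
theorem forall_hasSurjectiveModNGaloisRep_three_pow_of_frobenius (W : WeierstrassCurve ℚ)
    [W.IsElliptic] [W.IsGloballyMinimal] [Fact (Nat.Prime 3)] (h1 : W.HasSurjectiveModNGaloisRep 3)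
    (ℓ : ℕ) [hℓ : Fact ℓ.Prime] (hgood : W.HasGoodReductionAtPrime ℓ)
    (hℓ9 : ℓ % 9 = 2 ∨ ℓ % 9 = 5) (ha9 : W.frobeniusTrace ℓ % 9 = 3 ∨ W.frobeniusTrace ℓ % 9 = 6)
    (n : ℕ) : W.HasSurjectiveModNGaloisRep (3 ^ n : ℕ) := by
  have hp : Nat.Prime 3 := Fact.out
  have hp0 : ((3 : ℕ) : ℚ) ≠ 0 := by norm_num
  have hℓ3 : ℓ ≠ 3 := by omega
  haveI : Module.Free ℤ_[3] (W.tateModule 3) := module_free_tateModule_holds W 3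
  haveI : Module.Finite ℤ_[3] (W.tateModule 3) := module_finite_tateModule_holds W 3
  let b : Module.Basis (Fin 2) ℤ_[3] (W.tateModule 3) :=
    Module.finBasisOfFinrankEq ℤ_[3] _ (finrank_tateModule_eq_two_holds W 3 hp0)
  -- an arithmetic Frobenius at `ℓ`, its trace and determinant on `T_3E`
  set v : HeightOneSpectrum (𝓞 ℚ) := (primesEquiv (R := 𝓞 ℚ)).symm ⟨ℓ, hℓ.out⟩ with hvdef
  have hvℓ : (primesEquiv v : ℕ) = ℓ := by rw [hvdef, Equiv.apply_symm_apply]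
  obtain ⟨𝔓, h𝔓⟩ := v.primesAbove_nonempty
  obtain ⟨φ, hφ⟩ := HeightOneSpectrum.exists_isArithFrobAt_of_mem_primesAbove_holds (v := v) h𝔓
  have hne : (primesEquiv v : ℕ) ≠ 3 := hvℓ ▸ hℓ3
  have hgood' : W.HasGoodReductionAt v :=
    (hasGoodReductionAtPrime_primesEquiv_iff_holds W v ℓ hvℓ).mp hgood
  set G := LinearMap.toMatrix b b (W.galoisRepTate 3 φ) with hG
  have htrG : G.trace = (W.frobeniusTrace ℓ : ℤ_[3]) := by
    rw [hG, ← LinearMap.trace_eq_matrix_trace ℤ_[3] b,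
      W.trace_galoisRepTate_frobenius_eq_frobeniusTrace 3 hne hgood' h𝔓 hφ, hvℓ]
  have hdetG : G.det = (ℓ : ℤ_[3]) := by
    rw [hG, LinearMap.det_toMatrix, det_galoisRepTate_frobenius_of_hasGoodReductionAt_holds W 3 v
      (natCast_not_mem_asIdeal_of_primesEquiv_ne hp hne) hgood' h𝔓 hφ,
      natCard_residueField_adicCompletionIntegers v, hvℓ]
  -- `a_ℓ = 3 a'`, `ℓ + 1 = 3 l'` with `3 ∤ a' l'`
  obtain ⟨a', ha'⟩ : ∃ a' : ℤ, W.frobeniusTrace ℓ = 3 * a' := ⟨W.frobeniusTrace ℓ / 3, by omega⟩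
  have ha'3 : ¬ ((3 : ℕ) : ℤ) ∣ a' := by omega
  obtain ⟨l', hl'⟩ : ∃ l' : ℤ, (ℓ : ℤ) + 1 = 3 * l' := ⟨((ℓ : ℤ) + 1) / 3, by omega⟩
  have hl'3 : ¬ ((3 : ℕ) : ℤ) ∣ l' := by omega
  have ha'u : IsUnit ((a' : ℤ) : ℤ_[3]) := isUnit_intCast_of_not_dvd ha'3
  have hl'u : IsUnit ((l' : ℤ) : ℤ_[3]) := isUnit_intCast_of_not_dvd hl'3
  have h2u : IsUnit (2 : ℤ_[3]) := by
    have h := isUnit_intCast_of_not_dvd (p := 3) (k := 2) (by omega)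
    rwa [Int.cast_ofNat] at h
  have haZ : (W.frobeniusTrace ℓ : ℤ_[3]) = 3 * (a' : ℤ_[3]) := by rw [ha']; push_cast; ring
  have hlZ : (ℓ : ℤ_[3]) = 3 * (l' : ℤ_[3]) - 1 := by
    have : (ℓ : ℤ) = 3 * l' - 1 := by omega
    exact_mod_cast congrArg (Int.cast : ℤ → ℤ_[3]) this
  -- the witness `M₀ = a' G - l'`
  set M₀ : Matrix (Fin 2) (Fin 2) ℤ_[3] := (a' : ℤ_[3]) • G - (l' : ℤ_[3]) • 1 with hM₀def
  have hM₀ : ∃ (τ : absoluteGaloisGroup ℚ) (V : Matrix (Fin 2) (Fin 2) ℤ_[3]),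
      LinearMap.toMatrix b b (W.galoisRepTate 3 τ) =
        1 + ((3 : ℕ) : ℤ_[3]) • M₀ + (((3 : ℕ) : ℤ_[3]) ^ 2) • V := by
    refine ⟨φ * φ, 0, ?_⟩
    rw [map_mul, LinearMap.toMatrix_mul, ← hG, mat_mul_self_eq, htrG, hdetG, haZ, hlZ, hM₀def,
      Nat.cast_ofNat, smul_zero, add_zero, smul_sub, smul_smul, smul_smul, sub_smul, one_smul]
    abel
  -- `M₀ mod 3` is not a scalar
  have hM₀10 : M₀ 1 0 = a' * G 1 0 := by
    simp [hM₀def, Matrix.one_apply_ne (show (1 : Fin 2) ≠ 0 by decide)]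
  have hM₀01 : M₀ 0 1 = a' * G 0 1 := by
    simp [hM₀def, Matrix.one_apply_ne (show (0 : Fin 2) ≠ 1 by decide)]
  have hM₀d : M₀ 0 0 - M₀ 1 1 = a' * (G 0 0 - G 1 1) := by
    simp [hM₀def]; ring
  have hnsG : IsUnit (G 1 0) ∨ IsUnit (G 0 1) ∨ IsUnit (G 0 0 - G 1 1) := by
    by_contra hcon
    push Not at hcon
    obtain ⟨h10, h01, hd⟩ := hcon
    have h3 : (3 : ℤ_[3]) = ((3 : ℕ) : ℤ_[3]) := by norm_num
    have hd10 : (3 : ℤ_[3]) ∣ G 1 0 := h3 ▸ p_dvd_of_not_isUnit h10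
    have hd01 : (3 : ℤ_[3]) ∣ G 0 1 := h3 ▸ p_dvd_of_not_isUnit h01
    have hdd : (3 : ℤ_[3]) ∣ G 0 0 - G 1 1 := h3 ▸ p_dvd_of_not_isUnit hd
    have hsum : (3 : ℤ_[3]) ∣ G 0 0 + G 1 1 := by
      rw [← Matrix.trace_fin_two, htrG, haZ]; exact dvd_mul_right 3 _
    have h00 : (3 : ℤ_[3]) ∣ G 0 0 := by
      have h2 : (3 : ℤ_[3]) ∣ 2 * G 0 0 := by
        have := dvd_add hsum hdd
        rwa [show G 0 0 + G 1 1 + (G 0 0 - G 1 1) = 2 * G 0 0 by ring] at this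
      exact (h2u.dvd_mul_left).mp h2
    have h11 : (3 : ℤ_[3]) ∣ G 1 1 := by
      have := dvd_sub hsum h00
      rwa [add_sub_cancel_left] at this
    have hdet3 : (3 : ℤ_[3]) ∣ (ℓ : ℤ_[3]) := by
      rw [← hdetG, Matrix.det_fin_two]
      exact dvd_sub (dvd_mul_of_dvd_left h00 _) (dvd_mul_of_dvd_left hd01 _)
    have hℓ3' : ((3 : ℕ) : ℤ) ∣ (ℓ : ℤ) := by
      rw [← PadicInt.norm_int_lt_one_iff_dvd, Int.cast_natCast]
      rw [h3] at hdet3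
      exact (PadicInt.norm_lt_one_iff_dvd _).mpr hdet3
    omega
  have hns : IsUnit (M₀ 1 0) ∨ IsUnit (M₀ 0 1) ∨ IsUnit (M₀ 0 0 - M₀ 1 1) := by
    rw [hM₀10, hM₀01, hM₀d]
    rcases hnsG with h | h | h
    · exact Or.inl (ha'u.mul h)
    · exact Or.inr (Or.inl (ha'u.mul h))
    · exact Or.inr (Or.inr (ha'u.mul h))
  -- `tr M₀` is a unit
  have htrM₀ : IsUnit M₀.trace := by
    have h : M₀.trace = (l' : ℤ_[3]) + ((3 : ℕ) : ℤ_[3]) * ((a' : ℤ_[3]) * a' - l') := by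
      rw [hM₀def, Matrix.trace_sub, Matrix.trace_smul, Matrix.trace_smul, htrG, haZ,
        Matrix.trace_one, Fintype.card_fin]
      push_cast
      ring
    rw [h]
    exact isUnit_add_of_p_dvd hl'u (dvd_mul_right _ _)
  exact forall_hasSurjectiveModNGaloisRep_of_firstOrderWitness (p := 3) (by norm_num) h1 b M₀ hM₀
    hns htrM₀ n

/-- **surj(9) from surj(3) and the Frobenius certificate** (`ℓ ≡ 2,5`, `a_ℓ ≡ 3,6 (mod 9)`): the
finite-level form consumed by `forall_hasSurjectiveModNGaloisRep_three_pow_of_nine` and by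
`Kato2004.imageContainsSL2_three_iff_hasSurjectiveModNGaloisRep_nine`.
[cite: SerreAbelianLadic1968, Ch. IV §3.4, Lemma 3 (IV-23)] [cite: Elkies2006, Introduction (p. 1) and §1] -/
theorem hasSurjectiveModNGaloisRep_nine_of_frobenius (W : WeierstrassCurve ℚ)
    [W.IsElliptic] [W.IsGloballyMinimal] [Fact (Nat.Prime 3)] (h1 : W.HasSurjectiveModNGaloisRep 3)
    (ℓ : ℕ) [Fact ℓ.Prime] (hgood : W.HasGoodReductionAtPrime ℓ)
    (hℓ9 : ℓ % 9 = 2 ∨ ℓ % 9 = 5) (ha9 : W.frobeniusTrace ℓ % 9 = 3 ∨ W.frobeniusTrace ℓ % 9 = 6) :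
    W.HasSurjectiveModNGaloisRep 9 := by
  have h := forall_hasSurjectiveModNGaloisRep_three_pow_of_frobenius W h1 ℓ hgood hℓ9 ha9 2
  rwa [show ((3 ^ 2 : ℕ) : ℤ) = 9 by norm_num] at h

end ThreeAdic

end WeierstrassCurve

namespace Literature.NumberTheory.EllipticCurves

namespace Kato2004

open WeierstrassCurve

/-- **Kato's (12.5.2) at `p = 3` from surj(3) and ONE Frobenius certificate** (`ℓ` good,
`ℓ ≡ 2, 5 (mod 9)`, `a_ℓ ≡ 3, 6 (mod 9)`): the integrality hypothesis of Kato's Thms 12.5 (4) /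
13.4 (3) / 14.5 (3) / 17.4 (3) for `T = T_3E` (Astérisque 295, (12.5.2), p. 222: "There exists an
`O_λ`-basis of `T` for which the image of the homomorphism `Gal(ℚ̄/ℚ(ζ_{p^∞})) → GL_{O_λ}(T) ≃ GL₂(O_λ)`
contains `SL₂(ℤ_p)`"), decided by `(ℓ mod 9, a_ℓ mod 9)` for a curve with surjective mod-`3` image,
whatever its reduction at `3`.
[cite: Kato2004Asterisque, (12.5.2) in Thm. 12.5 (4) (p. 222), Thm. 17.4 (3) (p. 273)]
[cite: SerreAbelianLadic1968, Ch. IV §3.4, Lemma 3 (IV-23)] -/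
theorem imageContainsSL2_three_of_frobenius (W : WeierstrassCurve ℚ) [W.IsElliptic]
    [W.IsGloballyMinimal] [Fact (Nat.Prime 3)] (h1 : W.HasSurjectiveModNGaloisRep 3)
    (ℓ : ℕ) [Fact ℓ.Prime] (hgood : W.HasGoodReductionAtPrime ℓ)
    (hℓ9 : ℓ % 9 = 2 ∨ ℓ % 9 = 5) (ha9 : W.frobeniusTrace ℓ % 9 = 3 ∨ W.frobeniusTrace ℓ % 9 = 6) :
    ImageContainsSL2 W 3 :=
  imageContainsSL2_of_forall_hasSurjectiveModNGaloisRep W 3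
    (forall_hasSurjectiveModNGaloisRep_three_pow_of_frobenius W h1 ℓ hgood hℓ9 ha9)

end Kato2004

end Literature.NumberTheory.EllipticCurves

end
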